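import Summits.KontsevichZagierPeriods.KontsevichZagierPeriods.Theses.IsogenyCertificates
import Literature.NumberTheory.EllipticCurves.RealPeriod
import Literature.NumberTheory.EllipticCurves.XMapCertificate

/-!
# Disproof of `EffectiveXMapChains` (stmt-KontsevichZagierPeriods-10664) — standing adversary, gen 1

**Verdict so far: the crux RESISTS; no kill is available in principle from this side.** The crux is
`DegreeHypothesis → EffectiveConclusion` (§1, `effectiveXMapChains_iff`, by `Iff.rfl`). Over
`ℤ`-models the antecedent is TRUE (minimal x-rational datum degree ≤ 163 by Mazur–Kenku, `κ = 0`;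
the bridge `IsIsogenous ↔ HasXMapCertificate` is the only thing missing in the tree to discharge
it), so `¬ crux` would need `¬ EffectiveConclusion`, i.e. an equal-valued isogenous pair of real
periods NOT joined by a poly-log chain — which in truth (N ≤ 163, `O(N)` moves per datum, §5) is an
`O(1)` chain. A refutation could only come from a defect of the typed KZ calculus that breaks crux
#3 `XMapPeriodTransfer` itself (the route's kill criterion), and §5 + the numerics found none.

Findings (all theorems below are sorry-free; axioms ⊆ {propext, Classical.choice, Quot.sound}):

1. ANATOMY (§1). `IsDatum`, `DegreeHypothesis`, `ChainBound`, `EffectiveConclusion`, `heightLog`;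
   NB the typed nesting inside the hypothesis is `W ≠ 0 ∧ (identity ∧ degree bound)`.
2. REDUCTION = the real proof obligation (§2). `effectiveXMapChains_of_countedTransfer`: if crux #3
   holds with a chain-length bound `L N ≤ C₁·max(1,N)^d` depending only on the degree `N` of the
   datum USED (`CountedTransfer L`), the crux follows with `C = max(C₁,0)·max(c₀,1)^d`,
   `k = max(κ,0)·d` (checked real-exponent bookkeeping, incl. `max|A||B| > 0` from `Δ ≠ 0`, so no
   `log 0` junk). The Masser–Wüstholz layer is pure bookkeeping; provers should prove
   `CountedTransfer (fun N => C₁ * N)` (see 5) and discharge nothing else. Also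
   `effectiveXMapChains_of_conclusion`, `xMapPeriodTransfer_of_effective` (crux ∧ DegreeHypothesis
   ⇒ crux #3: a chain is an equivalence, `sum_mem_relations_of_chain`), and
   `exists_chain_of_mem_relations` (crux #3 gives chains of SOME length).
3. NON-VACUITY and VALUES (§3). The representations quantified over EXIST: `periodRep A B a h :
   KZ.IntegralRep 1` = `[{x³+Ax+B > 0}, a/√(x³+Ax+B)]` (domain/graph `ℚ`-semialgebraic by hand,
   integrability from `WeierstrassCurve.integrableOn_inv_sqrt_twoTorsionPolynomial'` with `ψ = 4P`),
   `periodRep_value : value = a · realPeriod ⟨0,0,0,A,B⟩` (`= a·∫_{P>0}dx/√P`), `realPeriod_pos`,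
   and for ANY `r` with the crux's domain/`EqOn` data `value_eq_of_isPeriodRep`, `value_eq_iff`
   (value equality ⇔ `a·Ω(E) = b·Ω(E')`: it pins `b/a`, whence the `(a,b)`-uniform bound).
4. LOAD-BEARING ANALYSIS of the conclusion's inner hypotheses (§4).
   * `r.value = r'.value` is LOAD-BEARING: `not_chainBoundNoValueEq L` for EVERY bound `L`
     (witness: identity datum `(X,1,1)` on `y² = x³ − x`, `a = 1`, `b = 2`; a chain would give
     `Ω = 2Ω` by soundness `KZ.Equivalent.value_eq_holds`, contradicting `Ω > 0`);
     `not_effectiveConclusion_noValueEq`.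
   * `0 < a`, `0 < b` are DECORATIVE: `chain_of_scalar_zero` (`a = 0` forces `b = 0`, then a chain of
     length 2; `chain_of_integrand_zero`: a zero-integrand representation is minus ONE
     integrand-additivity move, `0 = 0 + 0`).
   * `Δ ≠ 0` dropped ⇒ the instance is VACUOUS, not false (`1/√P` not integrable at a multiple
     root, so no `r` exists) — paper. `∃ datum` dropped ⇒ crux #4 `RealPeriodSectorComplete`
     territory (escapes would be ℚ̄-not-ℚ-isogenous pairs with rational real-period ratio; twists
     by `d > 0` give ratio `√d`, `d < 0` forces CM, and the CM-discriminant twist is ℚ-isogenous) —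
     not attackable from here.
   * `isDatum_refl`, `isDatum_lemniscate` (calibration data).
   TIGHTNESS of the antecedent (§6): `degreeHypothesis_const_ge_two` — every witness `(κ, c₀)` of
   `DegreeHypothesis` has `c₀ ≥ 2`, because the lemniscate pair `(−1,0) → (4,0)` (complexity
   `max(1, log 1) = 1`) admits NO datum of degree `≤ 1` (`no_datum_of_degree_le_one`, a checked
   coefficient chase: degree-≤1 data are isomorphisms ∘ 2-torsion translations); the antecedent is
   not satisfiable by trivial data.
5. THE MECHANISM HOLDS FOR EVERY DATUM (§5, the reason it resists): `c ≠ 0`, `g ≠ 0` forced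
   (`c_ne_zero_of_isDatum`, `g_ne_zero_of_isDatum`); pointwise `c²g⁴·P'(R) = P·W²`
   (`P'_comp_R_eq`), hence `P'(R x) > 0` off the zeros of `gW` (`P'_comp_R_pos`), critical values
   AND boundary images are roots of `P'` (`P'_comp_R_eq_zero_of_W_eq_zero`,
   `P'_comp_R_eq_zero_of_P_eq_zero`), `R(±∞)` finite is a root of `P'` (`limit_value_is_root`, with
   `wronskian_natDegree_le : deg W ≤ 2n − 2`), and the rule-2) integrand identity
   `a/√P = (a/|c|)/√P'(R)·|W/g²|` (`cov_integrand_identity`). Consequence (paper, and numerics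
   below): the fibre multiplicity of `R|{P>0}` is CONSTANT on each component of `{P'>0}` and every
   monotone piece maps onto a WHOLE component, so NO recombination of overlapping image intervals
   is needed: moves per datum `≤ (p + 1) + p + (m₀ + m₁ − 2) + 1 (Möbius egg'↔U', only when one
   of m₀, m₁ is 0) + 3 ≤ 3p + 5` with `p ≤ 3N + 1` pieces (`m₀ + m₁ = p`; cuts = real zeros of
   `g·W` in `{P>0}`, at most `N + (2N − 1)`). The planner's `O(N²)`/`k = 2κ` is generous: `k = κ`
   suffices.
6. NUMERICS — 73 analyses of rational cyclic isogenies, degrees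
   {2,3,4,5,6,7,9,11,13,14,15,17,19,21,25,37,43,67,163} (every sporadic degree over ℚ and the maximum
   163): (i) PARI 2.15 `ellisomat` x-maps with AGM periods `E.omega[1]` (job j014582, COMPLETE: 46
   isogenies — classes 11a, 14a, 15a, 32a, 36a, 27a, 49a, 50a (3, 5, 15), 162 (3, 7, 21), the X₀(7)-
   and X₀(13)-points, the eleven sporadic pairs: both curves of 1225.b (37), CM−43, CM−67, CM−163,
   CM−11, CM−19, j = −11², j = −11·131³, j = −17²·101³/2 (17)); (ii) an independent python-flint +
   mpmath replication (job j014445, COMPLETE: 27 isogenies up to ℓ = 67; kernel polynomial = product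
   of factors of the ℓ-division polynomial — for j = −7·11³ the 37-kernel is the product of three
   rational SEXTICS —, x-map by Vélu, periods by complete-elliptic-integral closed forms; twist-reduced
   models, e.g. the 37-isogeny on `y² = x³ − 1155x − 16450`, the 67-isogeny on
   `y² = x³ − 29480x − 1948226`). The earlier partial runs j007860/j009119 agree where they overlap.
   In EVERY case: the datum identity holds EXACTLY with `c² = 1` (`1/u²` after rescaling the target
   to an integral model); `badpieces = badcrit = nonmono = 0` — every monotone piece of `{P>0}` (cut
   at the real zeros of `g·W`) maps onto a WHOLE component of `{P'>0}` and every critical value is a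
   root of `P'` (§5, proved); the piece count is `p = m₀ + m₁ = d_ℝ·c(E)` (real covering degree ×
   number of real components of the source) `≤ 2N`, far below `3N + 1`: `11a3 → 11a2` (N = 25):
   p = 25; X₀(7)-point: p = 14 = 7+7; X₀(13)-point: p = 26 = 13+13; `50a` 15-isogeny: p = 3;
   [2]-type 2-isogenies: p = 2 or 4; and for ALL ELEVEN sporadic isogenies (ℓ = 11, 17, 19, 21, 37,
   43, 67, 163) p = 1 — `R` is a monotone BIJECTION `{P>0} → {P'>0}` and the transfer is ONE rule-2
   move (the 163-isogeny: `deg f = 163`, `deg g = 162`, analysed in 1142 s). Multiplicities are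
   `(m₀,m₁) ∈ {(d,d), (d,0)}`; the Möbius/`[2]` egg step is needed exactly when `c(E') = 2 ∧ m₁ = 0`
   (13 of 73). The period identity `|c|·Ω_E = m₀·Ω_U' + m₁·Ω_egg'` holds to relative `10⁻⁵⁷`
   (PARI, AGM; `0.e-57` printed in every case) resp. `10⁻⁴⁸ … 10⁻⁶²` (python closed forms) /
   `10⁻³³` (two-component targets, egg by tanh-sinh), and `Ω_U' = Ω_egg'` to `10⁻⁴⁰ … 10⁻⁵⁸`; the
   v1 quadrature lost digits on large-coefficient targets (a pure quadrature-scaling artefact,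
   diagnosed and removed in v2 — no structural anomaly anywhere). PARI's p-restricted
   `ellisomat(E,p)` hung on the X₀(13) curve (v1; v2 uses `ellisomat(E)`); ψ₁₆₃ is out of reach of
   division polynomials (13 284 coefficients of ~10⁴⁰⁰⁰⁰ digits), PARI's CM machinery found the
   163-isogeny in 0.9 s. Raw tables: item evidence `numerics-j014445.txt`, `numerics-j014582.txt`.
7. NATURAL STRENGTHENINGS: `k = 0` (absolute constant) is TRUE over `ℤ` in truth (N ≤ 163) — not
   refutable; the number-field version (informal item 6725), where Masser–Wüstholz is genuinely
   load-bearing, is untyped. Nothing refutable found that a prover might be tempted to use.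
8. LANDED in the tree (importable; namespace `Summit.KontsevichZagierPeriods.IsogenyCertificates.
   EffectiveXMapChainsNegative`; under `Summits/…/Theorems/EffectiveXMapChains/Negative/`):
   `CountedTransfer.lean` (p74209 ACCEPTED: §2 with hypotheses spelled out — `moves`, `heightLog`,
   `sum_mem_relations_of_chain`, `exists_chain_of_mem_relations`, `effectiveXMapChains_of_conclusion`,
   `effectiveXMapChains_of_countedTransfer`, `xMapPeriodTransfer_of_effective`), `Mechanism.lean`
   (p74222 ACCEPTED: §5 — `c_ne_zero_of_datum`, `g_ne_zero_of_wronskian_ne_zero`, `xMapIdentity_aeval`,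
   `P'_comp_R_eq`, `P'_comp_R_pos`, `P'_comp_R_eq_zero_of_W_eq_zero`, `P'_comp_R_eq_zero_of_P_eq_zero`,
   `cov_integrand_identity`), `LimitValue.lean` (p74391 ACCEPTED: `wronskian_natDegree_le`,
   `limit_value_is_root`), `PeriodRep.lean` (p74608 ACCEPTED: §3–§4 — `periodRep`, `periodRep_value`,
   `value_eq_iff`, `not_chainBound_without_valueEq`, `chain_of_scalar_zero`, …). NB for seats writing
   under `Summits/…/Theorems/`: NO `Prop`-valued `def`s there (the gate relocates cited closed Props to
   `Literature/` as facts — p73222/p73223 bounced that way); spell hypotheses out.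
9. Targets: none handed over (no stuck stubs). Near-misses: none. Sibling seat (crux #3
   `XMapPeriodTransfer`, `Cruxes/XMapPeriodTransfer/Disproof.lean`) independently reaches the same
   verdict (no kill short of Conjecture 1 on an equal-valued pair; multiplicities `m₀, m₁` essential).
-/

noncomputable section

set_option linter.dupNamespace false

namespace Summit.KontsevichZagierPeriods.KontsevichZagierPeriods.Cruxes.EffectiveXMapChains.Disproof

open Polynomial Set MeasureTheory
open Literature.NumberTheory.Transcendental
open Summit.KontsevichZagierPeriods.KontsevichZagierPeriods.Theses.IsogenyCertificates

/-! ## §1 Anatomy of the crux: `EffectiveXMapChains ↔ (DegreeHypothesis → EffectiveConclusion)` -/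

/-- The x-map identity `c²·g·(f³ + A'fg² + B'g³) = (X³+AX+B)·(f'g − fg')²` of the datum. -/
def XMapIdentity (A B A' B' : ℤ) (f g : ℚ[X]) (c : ℚ) : Prop :=
  C (c ^ 2) * g * (f ^ 3 + C (A' : ℚ) * f * g ^ 2 + C (B' : ℚ) * g ^ 3) =
    (X ^ 3 + C (A : ℚ) * X + C (B : ℚ)) * (derivative f * g - f * derivative g) ^ 2

/-- The x-rational isogeny datum `(f, g, c)` from `y² = X³+AX+B` to `y² = X³+A'X+B'` inlined four
times in the crux: `W = f'g − fg' ≠ 0` and `c²·g·(f³ + A'fg² + B'g³) = (X³+AX+B)·W²`. -/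
def IsDatum (A B A' B' : ℤ) (f g : ℚ[X]) (c : ℚ) : Prop :=
  derivative f * g - f * derivative g ≠ 0 ∧ XMapIdentity A B A' B' f g c

/-- The four generating move sets of the KZ calculus, as one set. -/
def moves : Set KZ.FormalRep :=
  KZ.domainAddRel ∪ KZ.integrandAddRel ∪ KZ.changeOfVariablesRel ∪ KZ.newtonLeibnizRel

/-- `l` is a chain of signed move instances summing to `d` (word of length `l.length`). -/
def IsSignedChain (l : List KZ.FormalRep) (d : KZ.FormalRep) : Prop :=
  (∀ x ∈ l, x ∈ moves ∨ -x ∈ moves) ∧ l.sum = d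

/-- The MW/Gaudron–Rémond-type antecedent of the crux (x-map form, naive height of `(A, B)`).
NB the typed nesting is `W ≠ 0 ∧ (identity ∧ degree bound)` (`∧` is right-associative). -/
def DegreeHypothesis : Prop :=
  ∃ κ c₀ : ℝ, ∀ (A B A' B' : ℤ), 4 * A ^ 3 + 27 * B ^ 2 ≠ 0 → 4 * A' ^ 3 + 27 * B' ^ 2 ≠ 0 →
    (∃ (f g : ℚ[X]) (c : ℚ), IsDatum A B A' B' f g c) →
    ∃ (f g : ℚ[X]) (c : ℚ), derivative f * g - f * derivative g ≠ 0 ∧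
      (XMapIdentity A B A' B' f g c ∧
        ((max f.natDegree g.natDegree : ℕ) : ℝ) ≤
          c₀ * (max 1 (Real.log (max |(A : ℝ)| |(B : ℝ)|))) ^ κ)

/-- The conclusion of the crux with an abstract length bound `L A B A' B'`. -/
def ChainBound (L : ℤ → ℤ → ℤ → ℤ → ℝ) : Prop :=
  ∀ (A B A' B' : ℤ), 4 * A ^ 3 + 27 * B ^ 2 ≠ 0 → 4 * A' ^ 3 + 27 * B' ^ 2 ≠ 0 →
    (∃ (f g : ℚ[X]) (c : ℚ), IsDatum A B A' B' f g c) →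
    ∀ (a b : ℚ), 0 < a → 0 < b → ∀ (r r' : KZ.IntegralRep 1),
      r.domain = {x | 0 < x 0 ^ 3 + (A : ℝ) * x 0 + (B : ℝ)} →
      EqOn r.integrand (fun x => (a : ℝ) / Real.sqrt (x 0 ^ 3 + (A : ℝ) * x 0 + (B : ℝ))) r.domain →
      r'.domain = {x | 0 < x 0 ^ 3 + (A' : ℝ) * x 0 + (B' : ℝ)} →
      EqOn r'.integrand (fun x => (b : ℝ) / Real.sqrt (x 0 ^ 3 + (A' : ℝ) * x 0 + (B' : ℝ)))
        r'.domain →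
      r.value = r'.value →
      ∃ l : List KZ.FormalRep, (l.length : ℝ) ≤ L A B A' B' ∧
        (∀ x ∈ l, x ∈ moves ∨ -x ∈ moves) ∧ l.sum = KZ.of r - KZ.of r'

/-- `max(1, log H)` with `H = max(|A|,|B|,|A'|,|B'|)`, the crux's complexity parameter. -/
def heightLog (A B A' B' : ℤ) : ℝ :=
  max 1 (Real.log (max (max |(A : ℝ)| |(B : ℝ)|) (max |(A' : ℝ)| |(B' : ℝ)|)))

/-- The consequent of the crux: poly-log chain length. -/
def EffectiveConclusion : Prop :=
  ∃ C k : ℝ, ChainBound fun A B A' B' => C * heightLog A B A' B' ^ k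

/-- **Anatomy.** The crux is literally `DegreeHypothesis → EffectiveConclusion`. -/
theorem effectiveXMapChains_iff :
    EffectiveXMapChains ↔ (DegreeHypothesis → EffectiveConclusion) :=
  Iff.rfl

/-! ## §2 Logical status: the antecedent is not load-bearing for truth; reduction to counted transfer -/

/-- The crux follows from its consequent alone (the degree hypothesis is used by the PROOF, not by
the truth value: over `ℤ`-models it holds with `κ = 0` by Mazur–Kenku). -/
theorem effectiveXMapChains_of_conclusion (h : EffectiveConclusion) : EffectiveXMapChains :=
  fun _ => h

/-- **Counted transfer**: crux #3 `XMapPeriodTransfer` with a chain-length bound `L N` depending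
only on the degree `N = max (deg f) (deg g)` of the datum used. This is what a prover must really
establish (the plan gives `L N = O(N)`–`O(N²)`). -/
def CountedTransfer (L : ℕ → ℝ) : Prop :=
  ∀ (A B A' B' : ℤ), 4 * A ^ 3 + 27 * B ^ 2 ≠ 0 → 4 * A' ^ 3 + 27 * B' ^ 2 ≠ 0 →
    ∀ (f g : ℚ[X]) (c : ℚ), IsDatum A B A' B' f g c →
    ∀ (a b : ℚ), 0 < a → 0 < b → ∀ (r r' : KZ.IntegralRep 1),
      r.domain = {x | 0 < x 0 ^ 3 + (A : ℝ) * x 0 + (B : ℝ)} →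
      EqOn r.integrand (fun x => (a : ℝ) / Real.sqrt (x 0 ^ 3 + (A : ℝ) * x 0 + (B : ℝ))) r.domain →
      r'.domain = {x | 0 < x 0 ^ 3 + (A' : ℝ) * x 0 + (B' : ℝ)} →
      EqOn r'.integrand (fun x => (b : ℝ) / Real.sqrt (x 0 ^ 3 + (A' : ℝ) * x 0 + (B' : ℝ)))
        r'.domain →
      r.value = r'.value →
      ∃ l : List KZ.FormalRep, (l.length : ℝ) ≤ L (max f.natDegree g.natDegree) ∧
        (∀ x ∈ l, x ∈ moves ∨ -x ∈ moves) ∧ l.sum = KZ.of r - KZ.of r'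

/-- Nonsingular coefficients are not both zero, so `max |A| |B| > 0` (no `log 0` junk). -/
lemma max_abs_pos_of_disc_ne_zero {A B : ℤ} (h : 4 * A ^ 3 + 27 * B ^ 2 ≠ 0) :
    0 < max |(A : ℝ)| |(B : ℝ)| := by
  rcases eq_or_ne A 0 with rfl | hA
  · rcases eq_or_ne B 0 with rfl | hB
    · simp at h
    · exact lt_max_of_lt_right (by exact_mod_cast abs_pos.mpr hB)
  · exact lt_max_of_lt_left (by exact_mod_cast abs_pos.mpr hA)

/-- `max(1, log max(|A|,|B|)) ≤ heightLog A B A' B'`. -/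
lemma heightLog_ge {A B : ℤ} (A' B' : ℤ) (h : 4 * A ^ 3 + 27 * B ^ 2 ≠ 0) :
    max 1 (Real.log (max |(A : ℝ)| |(B : ℝ)|)) ≤ heightLog A B A' B' :=
  max_le_max le_rfl (Real.log_le_log (max_abs_pos_of_disc_ne_zero h) (le_max_left _ _))

lemma one_le_heightLog (A B A' B' : ℤ) : 1 ≤ heightLog A B A' B' := le_max_left _ _

/-- **Reduction (the proof skeleton, checked).** Counted transfer with a polynomially bounded
`L` implies the crux: with `N ≤ c₀·M^κ` from the degree hypothesis (`M = max(1, log max(|A|,|B|))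
≤ heightLog`), the length is `≤ max(C₁,0)·max(c₀,1)^d · heightLog^{max(κ,0)·d}`. So the whole
Masser–Wüstholz layer of the crux is this bookkeeping; everything else is `CountedTransfer`. -/
theorem effectiveXMapChains_of_countedTransfer {L : ℕ → ℝ} {C₁ d : ℝ} (hd : 0 ≤ d)
    (hL : ∀ N : ℕ, L N ≤ C₁ * (max 1 (N : ℝ)) ^ d) (H : CountedTransfer L) :
    EffectiveXMapChains := by
  rintro ⟨κ, c₀, hyp⟩
  refine ⟨max C₁ 0 * (max c₀ 1) ^ d, max κ 0 * d, ?_⟩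
  intro A B A' B' hΔ hΔ' hdat a b ha hb r r' h1 h2 h3 h4 h5
  obtain ⟨f, g, c, hW, hI, hdeg⟩ := hyp A B A' B' hΔ hΔ' hdat
  obtain ⟨l, hl, hmem, hsum⟩ := H A B A' B' hΔ hΔ' f g c ⟨hW, hI⟩ a b ha hb r r' h1 h2 h3 h4 h5
  refine ⟨l, hl.trans ?_, hmem, hsum⟩
  set N : ℕ := max f.natDegree g.natDegree with hN
  set M : ℝ := max 1 (Real.log (max |(A : ℝ)| |(B : ℝ)|)) with hM
  have hM1 : 1 ≤ M := le_max_left _ _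
  have hM0 : 0 ≤ M := zero_le_one.trans hM1
  have hH1 : 1 ≤ heightLog A B A' B' := one_le_heightLog A B A' B'
  have hH0 : 0 ≤ heightLog A B A' B' := zero_le_one.trans hH1
  have hMH : M ≤ heightLog A B A' B' := heightLog_ge A' B' hΔ
  set κ' : ℝ := max κ 0 with hκ'
  set c' : ℝ := max c₀ 1 with hc'
  have hκ'0 : 0 ≤ κ' := le_max_right _ _
  have hc'1 : 1 ≤ c' := le_max_right _ _
  have hc'0 : 0 ≤ c' := zero_le_one.trans hc'1
  -- N ≤ c' * M ^ κ'
  have hMκ : M ^ κ ≤ M ^ κ' := Real.rpow_le_rpow_of_exponent_le hM1 (le_max_left _ _)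
  have hMκpos : 0 < M ^ κ := Real.rpow_pos_of_pos (zero_lt_one.trans_le hM1) κ
  have hN1 : (N : ℝ) ≤ c' * M ^ κ' := by
    calc (N : ℝ) ≤ c₀ * M ^ κ := hdeg
      _ ≤ c' * M ^ κ := mul_le_mul_of_nonneg_right (le_max_left _ _) hMκpos.le
      _ ≤ c' * M ^ κ' := mul_le_mul_of_nonneg_left hMκ hc'0
  have hone : (1 : ℝ) ≤ c' * M ^ κ' :=
    one_le_mul_of_one_le_of_one_le hc'1 (Real.one_le_rpow hM1 hκ'0)
  have hmax : max 1 (N : ℝ) ≤ c' * M ^ κ' := max_le hone hN1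
  have hmax0 : 0 ≤ max 1 (N : ℝ) := zero_le_one.trans (le_max_left _ _)
  -- main estimate
  calc L N ≤ C₁ * (max 1 (N : ℝ)) ^ d := hL N
    _ ≤ max C₁ 0 * (max 1 (N : ℝ)) ^ d :=
        mul_le_mul_of_nonneg_right (le_max_left _ _) (Real.rpow_nonneg hmax0 d)
    _ ≤ max C₁ 0 * (c' * M ^ κ') ^ d :=
        mul_le_mul_of_nonneg_left (Real.rpow_le_rpow hmax0 hmax hd) (le_max_right _ _)
    _ = max C₁ 0 * (c' ^ d * M ^ (κ' * d)) := by
        rw [Real.mul_rpow hc'0 (Real.rpow_nonneg hM0 _), Real.rpow_mul hM0]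
    _ ≤ max C₁ 0 * (c' ^ d * heightLog A B A' B' ^ (κ' * d)) := by
        refine mul_le_mul_of_nonneg_left ?_ (le_max_right _ _)
        exact mul_le_mul_of_nonneg_left
          (Real.rpow_le_rpow hM0 hMH (mul_nonneg hκ'0 hd)) (Real.rpow_nonneg hc'0 d)
    _ = max C₁ 0 * c' ^ d * heightLog A B A' B' ^ (κ' * d) := by ring

/-- Any signed chain of moves sums to a relation of the calculus. -/
theorem sum_mem_relations_of_chain {l : List KZ.FormalRep}
    (hl : ∀ x ∈ l, x ∈ moves ∨ -x ∈ moves) : l.sum ∈ KZ.relations := by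
  induction l with
  | nil => simp
  | cons x t ih =>
    rw [List.sum_cons]
    refine add_mem ?_ (ih fun y hy => hl y (List.mem_cons_of_mem _ hy))
    rcases hl x List.mem_cons_self with hx | hx
    · exact AddSubgroup.subset_closure hx
    · have h' : -x ∈ KZ.relations := AddSubgroup.subset_closure hx
      simpa using KZ.relations.neg_mem h'

/-- Conversely every relation is the sum of some signed chain (no length information). -/
theorem exists_chain_of_mem_relations {d : KZ.FormalRep} (hd : d ∈ KZ.relations) :
    ∃ l : List KZ.FormalRep, IsSignedChain l d := by
  refine AddSubgroup.closure_induction (p := fun d _ => ∃ l : List KZ.FormalRep, IsSignedChain l d)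
    ?_ ?_ ?_ ?_ hd
  · intro x hx
    exact ⟨[x], fun y hy => by simp only [List.mem_singleton] at hy; exact Or.inl (hy ▸ hx),
      by simp⟩
  · exact ⟨[], fun y hy => by simp at hy, by simp⟩
  · rintro x y - - ⟨l₁, h₁, hs₁⟩ ⟨l₂, h₂, hs₂⟩
    refine ⟨l₁ ++ l₂, fun z hz => ?_, by simp [hs₁, hs₂]⟩
    rcases List.mem_append.mp hz with hz | hz
    · exact h₁ z hz
    · exact h₂ z hz
  · rintro x - ⟨l, h, hs⟩
    refine ⟨(l.map fun z => -z).reverse, fun z hz => ?_, ?_⟩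
    · simp only [List.mem_reverse, List.mem_map] at hz
      obtain ⟨w, hw, rfl⟩ := hz
      rcases h w hw with hw' | hw'
      · exact Or.inr (by simpa using hw')
      · exact Or.inl hw'
    · rw [← List.sum_neg_reverse, hs]

/-- **Granted the degree hypothesis, the effective crux implies crux #3 `XMapPeriodTransfer`**
(a chain is in particular an equivalence). -/
theorem xMapPeriodTransfer_of_effective (hD : DegreeHypothesis) (h : EffectiveXMapChains) :
    XMapPeriodTransfer := by
  obtain ⟨C, k, hC⟩ := h hD
  intro A B A' B' hΔ hΔ' f g c hW hI a b ha hb r r' h1 h2 h3 h4 h5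
  obtain ⟨l, -, hmem, hsum⟩ := hC A B A' B' hΔ hΔ' ⟨f, g, c, hW, hI⟩ a b ha hb r r' h1 h2 h3 h4 h5
  show KZ.of r - KZ.of r' ∈ KZ.relations
  rw [← hsum]
  exact sum_mem_relations_of_chain hmem


/-! ## §3 The period representations `[{P>0}, a/√P]` exist (non-vacuity) and their values

The crux quantifies over `r r' : KZ.IntegralRep 1` with prescribed domain and integrand-on-domain.
We construct them (semialgebraicity by hand, integrability from the tree's
`WeierstrassCurve.integrableOn_inv_sqrt_twoTorsionPolynomial'`, `ψ = 4P`), and compute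
`value = a · Ω(E_{A,B})` with `Ω = WeierstrassCurve.realPeriod ⟨0,0,0,A,B⟩ = ∫_{P>0} dx/√P > 0`.
-/

/-- The short Weierstrass model `y² = x³ + Ax + B` over `ℝ`. -/
def curve (A B : ℤ) : WeierstrassCurve ℝ := ⟨0, 0, 0, (A : ℝ), (B : ℝ)⟩

lemma curve_ψ (A B : ℤ) (t : ℝ) :
    (curve A B).twoTorsionPolynomial.toPoly.eval t = 4 * (t ^ 3 + (A : ℝ) * t + (B : ℝ)) := by
  simp only [curve, WeierstrassCurve.twoTorsionPolynomial, Cubic.toPoly, WeierstrassCurve.b₂,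
    WeierstrassCurve.b₄, WeierstrassCurve.b₆, eval_add, eval_mul, eval_C, eval_pow, eval_X]
  ring

lemma curve_Δ (A B : ℤ) : (curve A B).Δ = -16 * (4 * (A : ℝ) ^ 3 + 27 * (B : ℝ) ^ 2) := by
  simp only [curve, WeierstrassCurve.Δ, WeierstrassCurve.b₂, WeierstrassCurve.b₄,
    WeierstrassCurve.b₆, WeierstrassCurve.b₈]
  ring

lemma curve_isElliptic {A B : ℤ} (h : 4 * A ^ 3 + 27 * B ^ 2 ≠ 0) : (curve A B).IsElliptic := by
  rw [WeierstrassCurve.isElliptic_iff, curve_Δ, isUnit_iff_ne_zero]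
  refine mul_ne_zero (by norm_num) ?_
  exact_mod_cast h

lemma curve_twoTorsionSet (A B : ℤ) :
    (curve A B).twoTorsionSet = {t | 0 < t ^ 3 + (A : ℝ) * t + (B : ℝ)} := by
  ext t
  rw [WeierstrassCurve.mem_twoTorsionSet_iff, curve_ψ, mem_setOf_eq]
  exact mul_pos_iff_of_pos_left (by norm_num)

lemma sqrt_four_mul (u : ℝ) : Real.sqrt (4 * u) = 2 * Real.sqrt u := by
  rw [Real.sqrt_mul (by norm_num : (0 : ℝ) ≤ 4)]
  congr 1
  rw [show (4 : ℝ) = 2 ^ 2 by norm_num]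
  exact Real.sqrt_sq (by norm_num)

lemma div_sqrt_eq (a t : ℝ) (A B : ℤ) :
    a / Real.sqrt (t ^ 3 + (A : ℝ) * t + (B : ℝ)) =
      2 * a * (Real.sqrt ((curve A B).twoTorsionPolynomial.toPoly.eval t))⁻¹ := by
  rw [curve_ψ, sqrt_four_mul]
  by_cases hu : Real.sqrt (t ^ 3 + (A : ℝ) * t + (B : ℝ)) = 0
  · simp [hu]
  · field_simp

/-- Integrability of `a/√P` on `{P > 0} ⊆ ℝ` (from the tree's real-period file). -/
lemma integrableOn_real {A B : ℤ} (h : 4 * A ^ 3 + 27 * B ^ 2 ≠ 0) (a : ℝ) :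
    IntegrableOn (fun t : ℝ => a / Real.sqrt (t ^ 3 + (A : ℝ) * t + (B : ℝ)))
      {t | 0 < t ^ 3 + (A : ℝ) * t + (B : ℝ)} := by
  haveI := curve_isElliptic h
  have hint := (curve A B).integrableOn_inv_sqrt_twoTorsionPolynomial'
  rw [curve_twoTorsionSet] at hint
  have heq : (fun t : ℝ => a / Real.sqrt (t ^ 3 + (A : ℝ) * t + (B : ℝ))) =
      fun t => 2 * a * (Real.sqrt ((curve A B).twoTorsionPolynomial.toPoly.eval t))⁻¹ := by
    funext t; exact div_sqrt_eq a t A B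
  rw [heq]
  exact hint.const_mul (2 * a)

/-- The same on `ℝ¹ = Fin 1 → ℝ` (transport along `MeasurableEquiv.funUnique`). -/
lemma integrableOn_rep {A B : ℤ} (h : 4 * A ^ 3 + 27 * B ^ 2 ≠ 0) (a : ℝ) :
    IntegrableOn (fun x : Fin 1 → ℝ => a / Real.sqrt (x 0 ^ 3 + (A : ℝ) * x 0 + (B : ℝ)))
      {x | 0 < x 0 ^ 3 + (A : ℝ) * x 0 + (B : ℝ)} := by
  have he := MeasureTheory.volume_preserving_funUnique (Fin 1) ℝ
  exact (he.integrableOn_comp_preimage (MeasurableEquiv.measurableEmbedding _)).mpr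
    (integrableOn_real h a)

/-- `X₀³ + A X₀ + B` as a `ℚ`-polynomial in the variables `Fin n`. -/
def cubicMv (n : ℕ) (i : Fin n) (A B : ℤ) : MvPolynomial (Fin n) ℚ :=
  MvPolynomial.X i ^ 3 + MvPolynomial.C (A : ℚ) * MvPolynomial.X i + MvPolynomial.C (B : ℚ)

lemma aeval_cubicMv {n : ℕ} (i : Fin n) (A B : ℤ) (x : Fin n → ℝ) :
    MvPolynomial.aeval x (cubicMv n i A B) = x i ^ 3 + (A : ℝ) * x i + (B : ℝ) := by
  simp [cubicMv]

lemma isSemialgebraic_domain (A B : ℤ) :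
    Literature.ModelTheory.ExponentialFields.IsSemialgebraic ℚ
      {x : Fin 1 → ℝ | 0 < x 0 ^ 3 + (A : ℝ) * x 0 + (B : ℝ)} := by
  simpa [aeval_cubicMv] using
    Literature.ModelTheory.ExponentialFields.isSemialgebraic_setOf_eval_pos (k := ℚ) (R := ℝ)
      (cubicMv 1 0 A B)

/-- `y = a/√P ↔ y²P = a² ∧ a·y ≥ 0` for `P > 0` (semialgebraic description of the graph). -/
lemma eq_div_sqrt_iff {P y a : ℝ} (hP : 0 < P) :
    y = a / Real.sqrt P ↔ y ^ 2 * P - a ^ 2 = 0 ∧ 0 ≤ a * y := by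
  have hs : 0 < Real.sqrt P := Real.sqrt_pos.mpr hP
  have hsq : Real.sqrt P ^ 2 = P := Real.sq_sqrt hP.le
  constructor
  · rintro rfl
    refine ⟨?_, ?_⟩
    · rw [div_pow, hsq, div_mul_cancel₀ _ hP.ne', sub_self]
    · have : a * (a / Real.sqrt P) = a ^ 2 / Real.sqrt P := by ring
      rw [this]; positivity
  · rintro ⟨h1, h2⟩
    have h3 : (y * Real.sqrt P) ^ 2 = a ^ 2 := by rw [mul_pow, hsq]; linarith
    rw [eq_div_iff hs.ne']
    rcases sq_eq_sq_iff_eq_or_eq_neg.mp h3 with h4 | h4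
    · exact h4
    · have h5 : a = 0 := by nlinarith [mul_nonneg h2 hs.le, sq_nonneg a]
      subst h5; simpa using h4

lemma isSemialgebraicFunOn_integrand (A B : ℤ) (a : ℚ) :
    IsSemialgebraicFunOn ℚ {x : Fin 1 → ℝ | 0 < x 0 ^ 3 + (A : ℝ) * x 0 + (B : ℝ)}
      (fun x => (a : ℝ) / Real.sqrt (x 0 ^ 3 + (A : ℝ) * x 0 + (B : ℝ))) := by
  rw [isSemialgebraicFunOn_iff]
  have h1 := Literature.ModelTheory.ExponentialFields.isSemialgebraic_setOf_eval_pos (k := ℚ)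
    (R := ℝ) (cubicMv 2 0 A B)
  have h2 := Literature.ModelTheory.ExponentialFields.isSemialgebraic_setOf_eval_eq_zero (k := ℚ)
    (R := ℝ) (MvPolynomial.X 1 ^ 2 * cubicMv 2 0 A B - MvPolynomial.C (a ^ 2 : ℚ))
  have h3 := Literature.ModelTheory.ExponentialFields.isSemialgebraic_setOf_eval_nonneg (k := ℚ)
    (R := ℝ) (MvPolynomial.C (a : ℚ) * MvPolynomial.X (1 : Fin 2))
  convert h1.inter (h2.inter h3) using 1
  ext z
  simp only [mem_setOf_eq, mem_inter_iff, map_sub, map_mul, map_pow, MvPolynomial.aeval_X,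
    MvPolynomial.aeval_C, aeval_cubicMv, eq_ratCast]
  have e0 : Fin.init z 0 = z 0 := rfl
  have e1 : z (Fin.last 1) = z 1 := rfl
  rw [e0, e1]
  constructor
  · rintro ⟨hP, hy⟩
    exact ⟨hP, (eq_div_sqrt_iff hP).mp hy⟩
  · rintro ⟨hP, hy⟩
    exact ⟨hP, (eq_div_sqrt_iff hP).mpr hy⟩

/-- **The period representation** `[{x³+Ax+B > 0}, a/√(x³+Ax+B)]` as a KZ integral
representation (dimension 1). -/
def periodRep (A B : ℤ) (a : ℚ) (h : 4 * A ^ 3 + 27 * B ^ 2 ≠ 0) : KZ.IntegralRep 1 where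
  domain := {x | 0 < x 0 ^ 3 + (A : ℝ) * x 0 + (B : ℝ)}
  integrand := fun x => (a : ℝ) / Real.sqrt (x 0 ^ 3 + (A : ℝ) * x 0 + (B : ℝ))
  isSemialgebraic_domain := isSemialgebraic_domain A B
  isSemialgebraicFunOn_integrand := isSemialgebraicFunOn_integrand A B a
  integrableOn := integrableOn_rep h a

@[simp] lemma periodRep_domain (A B : ℤ) (a : ℚ) (h : 4 * A ^ 3 + 27 * B ^ 2 ≠ 0) :
    (periodRep A B a h).domain = {x | 0 < x 0 ^ 3 + (A : ℝ) * x 0 + (B : ℝ)} := rfl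

@[simp] lemma periodRep_integrand (A B : ℤ) (a : ℚ) (h : 4 * A ^ 3 + 27 * B ^ 2 ≠ 0) :
    (periodRep A B a h).integrand = fun x => (a : ℝ) / Real.sqrt (x 0 ^ 3 + (A : ℝ) * x 0 + (B : ℝ)) :=
  rfl

/-- `∫_{x ∈ ℝ¹, P(x₀) > 0} a/√P(x₀) = a · Ω(E_{A,B})`. -/
lemma setIntegral_rep (A B : ℤ) (a : ℝ) :
    ∫ x in {x : Fin 1 → ℝ | 0 < x 0 ^ 3 + (A : ℝ) * x 0 + (B : ℝ)},
        a / Real.sqrt (x 0 ^ 3 + (A : ℝ) * x 0 + (B : ℝ)) = a * (curve A B).realPeriod := by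
  have he := MeasureTheory.volume_preserving_funUnique (Fin 1) ℝ
  have h1 := he.setIntegral_preimage_emb (MeasurableEquiv.measurableEmbedding _)
    (fun t : ℝ => a / Real.sqrt (t ^ 3 + (A : ℝ) * t + (B : ℝ)))
    {t | 0 < t ^ 3 + (A : ℝ) * t + (B : ℝ)}
  refine h1.trans ?_
  have hmeas : MeasurableSet {t : ℝ | 0 < t ^ 3 + (A : ℝ) * t + (B : ℝ)} := by
    rw [← curve_twoTorsionSet]; exact (curve A B).measurableSet_twoTorsionSet
  rw [setIntegral_congr_fun hmeas (fun t _ => div_sqrt_eq a t A B), integral_const_mul,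
    WeierstrassCurve.realPeriod, curve_twoTorsionSet]
  ring

/-- **Value of the period representation**: `a · Ω(E)`, `Ω = ∫_{P>0} dx/√P` (`realPeriod`). -/
theorem periodRep_value (A B : ℤ) (a : ℚ) (h : 4 * A ^ 3 + 27 * B ^ 2 ≠ 0) :
    (periodRep A B a h).value = (a : ℝ) * (curve A B).realPeriod :=
  setIntegral_rep A B a

/-- Any representation with the crux's domain and integrand-on-domain has the same value. -/
theorem value_eq_of_isPeriodRep {A B : ℤ} {a : ℚ} {r : KZ.IntegralRep 1}
    (h1 : r.domain = {x | 0 < x 0 ^ 3 + (A : ℝ) * x 0 + (B : ℝ)})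
    (h2 : EqOn r.integrand (fun x => (a : ℝ) / Real.sqrt (x 0 ^ 3 + (A : ℝ) * x 0 + (B : ℝ)))
      r.domain) :
    r.value = (a : ℝ) * (curve A B).realPeriod := by
  unfold KZ.IntegralRep.value
  rw [setIntegral_congr_fun (KZ.IntegralRep.measurableSet_domain_holds r) h2, h1]
  exact setIntegral_rep A B a

lemma realPeriod_pos {A B : ℤ} (h : 4 * A ^ 3 + 27 * B ^ 2 ≠ 0) : 0 < (curve A B).realPeriod := by
  haveI := curve_isElliptic h
  exact (curve A B).realPeriod_pos'

/-- **Value equality pins the scalar ratio**: `r.value = r'.value ↔ a·Ω(E) = b·Ω(E')`. -/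
theorem value_eq_iff {A B A' B' : ℤ} {a b : ℚ} {r r' : KZ.IntegralRep 1}
    (h1 : r.domain = {x | 0 < x 0 ^ 3 + (A : ℝ) * x 0 + (B : ℝ)})
    (h2 : EqOn r.integrand (fun x => (a : ℝ) / Real.sqrt (x 0 ^ 3 + (A : ℝ) * x 0 + (B : ℝ)))
      r.domain)
    (h3 : r'.domain = {x | 0 < x 0 ^ 3 + (A' : ℝ) * x 0 + (B' : ℝ)})
    (h4 : EqOn r'.integrand (fun x => (b : ℝ) / Real.sqrt (x 0 ^ 3 + (A' : ℝ) * x 0 + (B' : ℝ)))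
      r'.domain) :
    r.value = r'.value ↔ (a : ℝ) * (curve A B).realPeriod = (b : ℝ) * (curve A' B').realPeriod := by
  rw [value_eq_of_isPeriodRep h1 h2, value_eq_of_isPeriodRep h3 h4]

/-! ## §4 Load-bearing analysis of the conclusion's inner hypotheses

* `r.value = r'.value` is LOAD-BEARING: without it the conclusion is false for every bound `L`
  (`not_chainBoundNoValueEq`), by soundness of the calculus and `Ω > 0`.
* `0 < a`, `0 < b` are DECORATIVE: the case `a = 0` forces `b = 0` and is joined by a chain of
  length `2` (`chain_of_scalar_zero`); zero-integrand representations are relations in two moves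
  (`chain_of_integrand_zero`).
* `4A³+27B² ≠ 0` dropped makes the instance vacuous rather than false (the integrand `1/√P` is then
  not integrable at the multiple root, so no `r : IntegralRep 1` exists) — recorded, not formalised.
* `∃ datum` dropped = crux #4 territory (`RealPeriodSectorComplete`): not attackable here.
-/

/-- The identity certificate `(X, 1, 1)` is a datum from `(A, B)` to itself. -/
theorem isDatum_refl (A B : ℤ) : IsDatum A B A B X 1 1 := by
  refine ⟨by simp, ?_⟩
  simp only [XMapIdentity, derivative_X, derivative_one, mul_one, mul_zero, sub_zero, one_pow,
    map_one]
  ring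

/-- The lemniscate `2`-isogeny datum `(X² − 1, X, 1)` from `(−1, 0)` to `(4, 0)` (calibration;
cf. `Literature.NumberTheory.EllipticCurves.hasXMapCertificate_lemniscate`). -/
theorem isDatum_lemniscate : IsDatum (-1) 0 4 0 (X ^ 2 - 1) X 1 := by
  have hw : derivative (X ^ 2 - 1 : ℚ[X]) * X - (X ^ 2 - 1) * derivative X = X ^ 2 + 1 := by
    simp only [derivative_sub, derivative_X_pow, derivative_one, derivative_X, Nat.cast_ofNat,
      map_ofNat, Nat.add_one_sub_one, pow_one]
    ring
  refine ⟨?_, ?_⟩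
  · rw [hw]
    intro h0
    have := congrArg (fun p : ℚ[X] => p.coeff 0) h0
    simp at this
  · simp only [XMapIdentity, hw]
    simp only [Int.cast_neg, Int.cast_one, map_neg, map_one, Int.cast_zero, map_zero,
      Int.cast_ofNat, map_ofNat, one_pow]
    ring

/-- A zero-integrand representation is (minus) ONE integrand-additivity move: `0 = 0 + 0`. -/
theorem neg_of_mem_moves_of_integrand_zero {n : ℕ} {r : KZ.IntegralRep n}
    (hr : EqOn r.integrand 0 r.domain) : -KZ.of r ∈ moves := by
  refine Or.inl (Or.inl (Or.inr ⟨n, r, r, r, rfl, rfl, ?_, by abel⟩))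
  intro x hx
  simp [hr hx]

/-- Two zero-integrand representations are joined by a chain of length `2`. -/
theorem chain_of_integrand_zero {n m : ℕ} {r : KZ.IntegralRep n} {r' : KZ.IntegralRep m}
    (hr : EqOn r.integrand 0 r.domain) (hr' : EqOn r'.integrand 0 r'.domain) :
    ∃ l : List KZ.FormalRep, l.length = 2 ∧ (∀ x ∈ l, x ∈ moves ∨ -x ∈ moves) ∧
      l.sum = KZ.of r - KZ.of r' := by
  refine ⟨[KZ.of r, -KZ.of r'], rfl, ?_, by simp [sub_eq_add_neg]⟩
  intro x hx
  simp only [List.mem_cons, List.not_mem_nil, or_false] at hx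
  rcases hx with rfl | rfl
  · exact Or.inr (neg_of_mem_moves_of_integrand_zero hr)
  · exact Or.inl (neg_of_mem_moves_of_integrand_zero hr')

/-- **`0 < a` is decorative.** With `a = 0` (everything else as in the crux) value equality forces
`b = 0`, and then a chain of length `2` joins `r` to `r'`. -/
theorem chain_of_scalar_zero {A B A' B' : ℤ} (hΔ' : 4 * A' ^ 3 + 27 * B' ^ 2 ≠ 0) {b : ℚ}
    {r r' : KZ.IntegralRep 1}
    (h1 : r.domain = {x | 0 < x 0 ^ 3 + (A : ℝ) * x 0 + (B : ℝ)})
    (h2 : EqOn r.integrand (fun x => ((0 : ℚ) : ℝ) / Real.sqrt (x 0 ^ 3 + (A : ℝ) * x 0 + (B : ℝ)))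
      r.domain)
    (h3 : r'.domain = {x | 0 < x 0 ^ 3 + (A' : ℝ) * x 0 + (B' : ℝ)})
    (h4 : EqOn r'.integrand (fun x => (b : ℝ) / Real.sqrt (x 0 ^ 3 + (A' : ℝ) * x 0 + (B' : ℝ)))
      r'.domain)
    (h5 : r.value = r'.value) :
    b = 0 ∧ ∃ l : List KZ.FormalRep, l.length = 2 ∧ (∀ x ∈ l, x ∈ moves ∨ -x ∈ moves) ∧
      l.sum = KZ.of r - KZ.of r' := by
  have hb : (b : ℝ) = 0 := by
    rw [value_eq_iff h1 h2 h3 h4] at h5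
    simp only [Rat.cast_zero, zero_mul] at h5
    exact (mul_eq_zero.mp h5.symm).resolve_right (realPeriod_pos hΔ').ne'
  have hb' : b = 0 := by exact_mod_cast hb
  refine ⟨hb', chain_of_integrand_zero (fun x hx => ?_) (fun x hx => ?_)⟩
  · simp [h2 hx]
  · simp [h4 hx, hb]

/-- The conclusion of the crux with the value-equality hypothesis DROPPED. -/
def ChainBoundNoValueEq (L : ℤ → ℤ → ℤ → ℤ → ℝ) : Prop :=
  ∀ (A B A' B' : ℤ), 4 * A ^ 3 + 27 * B ^ 2 ≠ 0 → 4 * A' ^ 3 + 27 * B' ^ 2 ≠ 0 →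
    (∃ (f g : ℚ[X]) (c : ℚ), IsDatum A B A' B' f g c) →
    ∀ (a b : ℚ), 0 < a → 0 < b → ∀ (r r' : KZ.IntegralRep 1),
      r.domain = {x | 0 < x 0 ^ 3 + (A : ℝ) * x 0 + (B : ℝ)} →
      EqOn r.integrand (fun x => (a : ℝ) / Real.sqrt (x 0 ^ 3 + (A : ℝ) * x 0 + (B : ℝ))) r.domain →
      r'.domain = {x | 0 < x 0 ^ 3 + (A' : ℝ) * x 0 + (B' : ℝ)} →
      EqOn r'.integrand (fun x => (b : ℝ) / Real.sqrt (x 0 ^ 3 + (A' : ℝ) * x 0 + (B' : ℝ)))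
        r'.domain →
      ∃ l : List KZ.FormalRep, (l.length : ℝ) ≤ L A B A' B' ∧
        (∀ x ∈ l, x ∈ moves ∨ -x ∈ moves) ∧ l.sum = KZ.of r - KZ.of r'

/-- **Value equality is load-bearing**: without it the conclusion fails for EVERY bound `L`
(witness: the identity datum on `y² = x³ − x`, `a = 1`, `b = 2`; a chain would force
`Ω = 2Ω`, contradicting `Ω > 0`, by soundness `KZ.Equivalent.value_eq_holds`). -/
theorem not_chainBoundNoValueEq (L : ℤ → ℤ → ℤ → ℤ → ℝ) : ¬ ChainBoundNoValueEq L := by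
  intro H
  have hΔ : 4 * (-1 : ℤ) ^ 3 + 27 * (0 : ℤ) ^ 2 ≠ 0 := by norm_num
  obtain ⟨l, -, hmem, hsum⟩ := H (-1) 0 (-1) 0 hΔ hΔ ⟨X, 1, 1, isDatum_refl (-1) 0⟩ 1 2 one_pos
    two_pos (periodRep (-1) 0 1 hΔ) (periodRep (-1) 0 2 hΔ) rfl (fun _ _ => rfl) rfl
    (fun _ _ => rfl)
  have hrel : KZ.of (periodRep (-1) 0 1 hΔ) - KZ.of (periodRep (-1) 0 2 hΔ) ∈ KZ.relations := by
    rw [← hsum]; exact sum_mem_relations_of_chain hmem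
  have hval : (periodRep (-1) 0 1 hΔ).value = (periodRep (-1) 0 2 hΔ).value :=
    KZ.Equivalent.value_eq_holds hrel
  rw [periodRep_value, periodRep_value] at hval
  have hpos := realPeriod_pos hΔ
  push_cast at hval
  linarith

/-- Corollary: the poly-log form of the conclusion also fails without value equality. -/
theorem not_effectiveConclusion_noValueEq :
    ¬ ∃ C k : ℝ, ChainBoundNoValueEq fun A B A' B' => C * heightLog A B A' B' ^ k :=
  fun ⟨_, _, h⟩ => not_chainBoundNoValueEq _ h

/-! ## §5 The algebraic mechanism behind the count holds for EVERY datum (why the plan resists)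

Pointwise over `ℝ`: `c²·g(x)⁴·P'(R x) = P(x)·W(x)²` with `R = f/g`, `W = f'g − fg'`. Hence on
`{P > 0}` minus the zeros of `g·W` one has `P'(R x) > 0` (pieces map INTO `{P' > 0}`, and rule 2)
applies with `|R'|/√P'(R) = |c|⁻¹/√P`), and at every cut point — a zero of `W` (critical point of
`R`) or a zero of `P` (boundary of `{P>0}`) with `g ≠ 0` — the value `R x` is a ROOT of `P'`; also
`R(∞)` (if finite) is a root of `P'` (degree count, not formalised). So the fibre multiplicity of
`R|{P>0}` is constant on each component of `{P'>0}` and every monotone piece maps onto a WHOLE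
component: no recombination of overlapping image intervals is needed and the move count is `O(N)`
in the datum degree (the plan's `O(N²)` is generous). `c ≠ 0`, `g ≠ 0` are forced.
-/

section Mechanism

variable {A B A' B' : ℤ} {f g : ℚ[X]} {c : ℚ}

/-- `g ≠ 0` is forced by `W ≠ 0`. -/
theorem g_ne_zero_of_isDatum (h : IsDatum A B A' B' f g c) : g ≠ 0 := by
  rintro rfl
  exact h.1 (by simp)

/-- The cubic `X³ + AX + B` is not the zero polynomial. -/
lemma cubic_ne_zero (A B : ℤ) : (X ^ 3 + C (A : ℚ) * X + C (B : ℚ) : ℚ[X]) ≠ 0 := by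
  have h3 : (X ^ 3 + C (A : ℚ) * X + C (B : ℚ) : ℚ[X]).coeff 3 = 1 := by
    simp only [coeff_add, coeff_X_pow, coeff_C_mul, coeff_X, coeff_C]
    norm_num
  intro h0
  rw [h0, coeff_zero] at h3
  exact zero_ne_one h3

/-- `c ≠ 0` is forced: `c = 0` would give `P·W² = 0`, hence `W = 0`. -/
theorem c_ne_zero_of_isDatum (h : IsDatum A B A' B' f g c) : c ≠ 0 := by
  rintro rfl
  obtain ⟨hW, hI⟩ := h
  simp only [XMapIdentity, ne_eq, OfNat.ofNat_ne_zero, not_false_eq_true, zero_pow, map_zero,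
    zero_mul] at hI
  rcases mul_eq_zero.mp hI.symm with hP | hW2
  · exact cubic_ne_zero A B hP
  · exact hW (pow_eq_zero_iff two_ne_zero |>.mp hW2)

/-- **Pointwise identity over `ℝ`**: `c²·g(x)·(f³ + A'fg² + B'g³)(x) = P(x)·W(x)²`. -/
theorem xMapIdentity_aeval (h : XMapIdentity A B A' B' f g c) (x : ℝ) :
    (c : ℝ) ^ 2 * aeval x g *
        (aeval x f ^ 3 + (A' : ℝ) * aeval x f * aeval x g ^ 2 + (B' : ℝ) * aeval x g ^ 3) =
      (x ^ 3 + (A : ℝ) * x + (B : ℝ)) * aeval x (derivative f * g - f * derivative g) ^ 2 := by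
  have := congrArg (aeval x) h
  simpa [map_mul, map_add, map_pow, aeval_C, aeval_X] using this

/-- `P'(R x) = P(x)·W(x)² / (c²·g(x)⁴)` with `R = f/g`, wherever `g(x) ≠ 0`. -/
theorem P'_comp_R_eq (h : XMapIdentity A B A' B' f g c) (hc : c ≠ 0) {x : ℝ}
    (hg : aeval x g ≠ 0) :
    (aeval x f / aeval x g) ^ 3 + (A' : ℝ) * (aeval x f / aeval x g) + (B' : ℝ) =
      (x ^ 3 + (A : ℝ) * x + (B : ℝ)) * aeval x (derivative f * g - f * derivative g) ^ 2 /
        ((c : ℝ) ^ 2 * aeval x g ^ 4) := by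
  have hid := xMapIdentity_aeval h x
  have hc' : (c : ℝ) ≠ 0 := by exact_mod_cast hc
  have hden : (c : ℝ) ^ 2 * aeval x g ^ 4 ≠ 0 := by positivity
  have key : (aeval x f / aeval x g) ^ 3 + (A' : ℝ) * (aeval x f / aeval x g) + (B' : ℝ) =
      (aeval x f ^ 3 + (A' : ℝ) * aeval x f * aeval x g ^ 2 + (B' : ℝ) * aeval x g ^ 3) /
        aeval x g ^ 3 := by
    field_simp
  rw [key, div_eq_div_iff (pow_ne_zero 3 hg) hden]
  linear_combination aeval x g ^ 3 * hid

/-- **Pieces map into `{P' > 0}`**: on `{P > 0}` minus the zeros of `g·W`, `P'(R x) > 0`. -/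
theorem P'_comp_R_pos (h : IsDatum A B A' B' f g c) {x : ℝ} (hP : 0 < x ^ 3 + (A : ℝ) * x + (B : ℝ))
    (hg : aeval x g ≠ 0) (hW : aeval x (derivative f * g - f * derivative g) ≠ 0) :
    0 < (aeval x f / aeval x g) ^ 3 + (A' : ℝ) * (aeval x f / aeval x g) + (B' : ℝ) := by
  have hc : (c : ℝ) ≠ 0 := by exact_mod_cast c_ne_zero_of_isDatum h
  rw [P'_comp_R_eq h.2 (c_ne_zero_of_isDatum h) hg]
  positivity

/-- **Critical values of `R` are roots of `P'`** (so the fibre multiplicity cannot jump inside a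
component of `{P' > 0}`). -/
theorem P'_comp_R_eq_zero_of_W_eq_zero (h : IsDatum A B A' B' f g c) {x : ℝ} (hg : aeval x g ≠ 0)
    (hW : aeval x (derivative f * g - f * derivative g) = 0) :
    (aeval x f / aeval x g) ^ 3 + (A' : ℝ) * (aeval x f / aeval x g) + (B' : ℝ) = 0 := by
  rw [P'_comp_R_eq h.2 (c_ne_zero_of_isDatum h) hg, hW]
  simp

/-- **Boundary points of `{P > 0}` map to roots of `P'`** (images of the pieces END at 2-torsion
abscissae of the target, i.e. pieces map onto whole components). -/
theorem P'_comp_R_eq_zero_of_P_eq_zero (h : IsDatum A B A' B' f g c) {x : ℝ} (hg : aeval x g ≠ 0)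
    (hP : x ^ 3 + (A : ℝ) * x + (B : ℝ) = 0) :
    (aeval x f / aeval x g) ^ 3 + (A' : ℝ) * (aeval x f / aeval x g) + (B' : ℝ) = 0 := by
  rw [P'_comp_R_eq h.2 (c_ne_zero_of_isDatum h) hg, hP]
  simp

/-- **The rule-2) integrand identity on a piece**: `a/√P(x) = (a/|c|)/√P'(R x) · |R'(x)|`,
`R' = W/g²` — exactly the hypothesis `f x = f' (Φ x) · |det Φ' x|` of `KZ.changeOfVariablesRel`. -/
theorem cov_integrand_identity (h : IsDatum A B A' B' f g c) {x : ℝ}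
    (hP : 0 < x ^ 3 + (A : ℝ) * x + (B : ℝ)) (hg : aeval x g ≠ 0)
    (hW : aeval x (derivative f * g - f * derivative g) ≠ 0) (a : ℝ) :
    a / Real.sqrt (x ^ 3 + (A : ℝ) * x + (B : ℝ)) =
      (a / |(c : ℝ)|) / Real.sqrt ((aeval x f / aeval x g) ^ 3 + (A' : ℝ) * (aeval x f / aeval x g)
          + (B' : ℝ)) *
        |aeval x (derivative f * g - f * derivative g) / aeval x g ^ 2| := by
  have hc : (c : ℝ) ≠ 0 := by exact_mod_cast c_ne_zero_of_isDatum h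
  set P : ℝ := x ^ 3 + (A : ℝ) * x + (B : ℝ) with hPdef
  set Wx : ℝ := aeval x (derivative f * g - f * derivative g) with hWdef
  set gx : ℝ := aeval x g with hgdef
  rw [P'_comp_R_eq h.2 (c_ne_zero_of_isDatum h) hg]
  have hsq : Real.sqrt (P * Wx ^ 2 / ((c : ℝ) ^ 2 * gx ^ 4)) = Real.sqrt P * |Wx| / (|(c : ℝ)| * gx ^ 2) := by
    rw [Real.sqrt_div' _ (by positivity), Real.sqrt_mul hP.le, Real.sqrt_sq_eq_abs,
      Real.sqrt_mul (sq_nonneg _), Real.sqrt_sq_eq_abs,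
      show gx ^ 4 = (gx ^ 2) ^ 2 by ring, Real.sqrt_sq (sq_nonneg _)]
  rw [hsq, abs_div, abs_of_nonneg (sq_nonneg gx)]
  have hsP : 0 < Real.sqrt P := Real.sqrt_pos.mpr hP
  have hWa : 0 < |Wx| := abs_pos.mpr hW
  have hca : 0 < |(c : ℝ)| := abs_pos.mpr hc
  have hg2 : 0 < gx ^ 2 := by positivity
  field_simp

/-- **The Wronskian drops two degrees**: if `deg f ≤ deg g = n ≥ 1` then
`deg (f'g − fg') ≤ 2n − 2` (the coefficients of `X^{2n−1}` of `f'g` and `fg'` are both `n·fₙ·gₙ`).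
Hence a coprime datum of degree `N` cuts `{P > 0}` in at most `(N) + (2N − 2)` points. [folklore] -/
theorem wronskian_natDegree_le (hf : f.natDegree ≤ g.natDegree) (hn : 1 ≤ g.natDegree) :
    (derivative f * g - f * derivative g).natDegree ≤ 2 * g.natDegree - 2 := by
  set n := g.natDegree with hn'
  have hf' : (derivative f).natDegree ≤ n - 1 :=
    (natDegree_derivative_le f).trans (Nat.sub_le_sub_right hf 1)
  have hg' : (derivative g).natDegree ≤ n - 1 := natDegree_derivative_le g
  have h1 : (derivative f * g).natDegree ≤ n - 1 + n :=
    natDegree_mul_le_of_le hf' le_rfl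
  have h2 : (f * derivative g).natDegree ≤ n + (n - 1) :=
    natDegree_mul_le_of_le hf hg'
  have htop : (derivative f * g - f * derivative g).coeff (n - 1 + n) = 0 := by
    rw [coeff_sub, coeff_mul_add_eq_of_natDegree_le hf' le_rfl,
      show n - 1 + n = n + (n - 1) by omega, coeff_mul_add_eq_of_natDegree_le hf hg',
      coeff_derivative, coeff_derivative, show n - 1 + 1 = n by omega]
    ring
  have hle : (derivative f * g - f * derivative g).natDegree ≤ n - 1 + n :=
    (natDegree_sub_le _ _).trans (max_le h1 (by simpa [add_comm] using h2))
  rw [natDegree_le_iff_coeff_eq_zero] at hle ⊢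
  intro j hj
  rcases lt_or_eq_of_le (show n - 1 + n ≤ j by omega) with h | h
  · exact hle j (by exact_mod_cast h)
  · rw [← h]; exact htop

/-- **`R(∞)` is a 2-torsion abscissa of the target.** For a datum `(f, g, c)` with `deg f ≤ deg g`
(so that `R = f/g` has the finite limit `L = fₙ/gₙ` at `±∞`, `n = deg g`; `L = 0` when
`deg f < deg g`): `P'(L) = L³ + A'L + B' = 0`. Proof: compare the coefficients of `X^{4n}` in
`c²·g·(f³ + A'fg² + B'g³) = P·W²`; on the right it vanishes since `deg W ≤ 2n − 2`
(`wronskian_natDegree_le`), on the left it is `c²·gₙ·(fₙ³ + A'fₙgₙ² + B'gₙ³)`. (Geometrically: the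
point at infinity maps to `O'` or to a rational 2-torsion point, AEC III.4.) Together with part 3
(`Mechanism`: critical values and finite boundary images are roots of `P'`) this is the last of the
four evaluations behind "every monotone piece of `{P>0}` maps onto a whole component of `{P'>0}`".
[cite: SilvermanAEC2009, III.4 (Remark 4.13.2)] -/
theorem limit_value_is_root (hW : derivative f * g - f * derivative g ≠ 0)
    (hI : C (c ^ 2) * g * (f ^ 3 + C (A' : ℚ) * f * g ^ 2 + C (B' : ℚ) * g ^ 3) =
      (X ^ 3 + C (A : ℚ) * X + C (B : ℚ)) * (derivative f * g - f * derivative g) ^ 2)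
    (hc : c ≠ 0) (hfg : f.natDegree ≤ g.natDegree) :
    (f.coeff g.natDegree / g.leadingCoeff) ^ 3 + (A' : ℚ) * (f.coeff g.natDegree / g.leadingCoeff)
      + (B' : ℚ) = 0 := by
  set n := g.natDegree with hn'
  have hg0 : g ≠ 0 := by rintro rfl; exact hW (by simp)
  have hgc : g.leadingCoeff ≠ 0 := leadingCoeff_ne_zero.mpr hg0
  have hn : 1 ≤ n := by
    -- if `n = 0` then `g` and `f` are constants and `W = 0`
    by_contra h0
    have hn0 : n = 0 := by omega
    have hf0 : f.natDegree = 0 := by omega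
    apply hW
    rw [eq_C_of_natDegree_eq_zero hn0, eq_C_of_natDegree_eq_zero hf0]
    simp
  -- the coefficient of X^{4n} on the right vanishes
  have hWdeg := wronskian_natDegree_le hfg hn
  have hR : ((X ^ 3 + C (A : ℚ) * X + C (B : ℚ)) *
      (derivative f * g - f * derivative g) ^ 2).coeff (4 * n) = 0 := by
    apply coeff_eq_zero_of_natDegree_lt
    have hP : (X ^ 3 + C (A : ℚ) * X + C (B : ℚ) : ℚ[X]).natDegree ≤ 3 := by
      refine (natDegree_add_le _ _).trans (max_le ((natDegree_add_le _ _).trans (max_le ?_ ?_)) ?_)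
      · simp
      · exact (natDegree_C_mul_le _ _).trans (by simp)
      · simp
    have hW2 : ((derivative f * g - f * derivative g) ^ 2).natDegree ≤ 2 * (2 * n - 2) :=
      natDegree_pow_le_of_le 2 hWdeg
    have := natDegree_mul_le_of_le hP hW2
    omega
  -- the coefficient of X^{4n} on the left is c² g_n (f_n³ + A' f_n g_n² + B' g_n³)
  have hQ : (f ^ 3 + C (A' : ℚ) * f * g ^ 2 + C (B' : ℚ) * g ^ 3).natDegree ≤ 3 * n := by
    refine (natDegree_add_le _ _).trans (max_le ((natDegree_add_le _ _).trans (max_le ?_ ?_)) ?_)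
    · exact natDegree_pow_le_of_le 3 hfg |>.trans (by omega)
    · calc (C (A' : ℚ) * f * g ^ 2).natDegree ≤ (C (A' : ℚ) * f).natDegree + (g ^ 2).natDegree :=
            natDegree_mul_le
        _ ≤ n + 2 * n := add_le_add ((natDegree_C_mul_le _ _).trans hfg) (natDegree_pow_le_of_le 2 le_rfl)
        _ = 3 * n := by ring
    · exact (natDegree_C_mul_le _ _).trans (natDegree_pow_le_of_le 3 le_rfl |>.trans (by omega))
  have hQc : (f ^ 3 + C (A' : ℚ) * f * g ^ 2 + C (B' : ℚ) * g ^ 3).coeff (3 * n) =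
      f.coeff n ^ 3 + (A' : ℚ) * f.coeff n * g.coeff n ^ 2 + (B' : ℚ) * g.coeff n ^ 3 := by
    rw [coeff_add, coeff_add, coeff_pow_of_natDegree_le hfg, mul_assoc, coeff_C_mul,
      show 3 * n = n + 2 * n by ring, coeff_mul_add_eq_of_natDegree_le hfg (natDegree_pow_le_of_le 2 le_rfl),
      coeff_pow_of_natDegree_le le_rfl, coeff_C_mul, show n + 2 * n = 3 * n by ring,
      coeff_pow_of_natDegree_le le_rfl]
    ring
  have hL : (C (c ^ 2) * g * (f ^ 3 + C (A' : ℚ) * f * g ^ 2 + C (B' : ℚ) * g ^ 3)).coeff (4 * n) =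
      c ^ 2 * (g.coeff n * (f.coeff n ^ 3 + (A' : ℚ) * f.coeff n * g.coeff n ^ 2 +
        (B' : ℚ) * g.coeff n ^ 3)) := by
    rw [mul_assoc, coeff_C_mul, show 4 * n = n + 3 * n by ring, coeff_mul_add_eq_of_natDegree_le le_rfl hQ, hQc]
  have key : c ^ 2 * (g.coeff n * (f.coeff n ^ 3 + (A' : ℚ) * f.coeff n * g.coeff n ^ 2 +
      (B' : ℚ) * g.coeff n ^ 3)) = 0 := by
    rw [← hL, hI, hR]
  have hgn : g.coeff n = g.leadingCoeff := rfl
  rw [hgn] at key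
  have key' : f.coeff n ^ 3 + (A' : ℚ) * f.coeff n * g.leadingCoeff ^ 2 + (B' : ℚ) * g.leadingCoeff ^ 3 = 0 := by
    rcases mul_eq_zero.mp key with h | h
    · exact absurd h (pow_ne_zero 2 hc)
    · rcases mul_eq_zero.mp h with h | h
      · exact absurd h hgc
      · exact h
  field_simp
  linear_combination key'

end Mechanism

/-! ## §6 Tightness of the antecedent's constant: `c₀ ≥ 2` (degree-one data never join the lemniscate pair)

A datum of degree `≤ 1` is an isomorphism possibly composed with a rational 2-torsion translation;
the lemniscate pair `(−1,0) → (4,0)` admits the degree-2 datum `(X²−1, X, 1)` but NO datum with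
`max (deg f) (deg g) ≤ 1` (coefficient chase below), and for it `max(1, log max(|A|,|B|)) = 1`, so any
admissible `(κ, c₀)` in `DegreeHypothesis` has `c₀ ≥ 2`: the antecedent is not satisfiable by
trivial data — genuine isogenies are forced.
-/

section Tightness

/-- Evaluation of the x-map identity for linear `f = pX + q`, `g = sX + t` at a rational point. -/
lemma eval_identity_linear {p q s t c : ℚ}
    (hI : XMapIdentity (-1) 0 4 0 (C p * X + C q) (C s * X + C t) c) (x₀ : ℚ) :
    c ^ 2 * (s * x₀ + t) * ((p * x₀ + q) ^ 3 + 4 * (p * x₀ + q) * (s * x₀ + t) ^ 2) =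
      (x₀ ^ 3 - x₀) * (p * t - q * s) ^ 2 := by
  have hW : derivative (C p * X + C q) * (C s * X + C t) - (C p * X + C q) * derivative (C s * X + C t)
      = C (p * t - q * s) := by
    simp only [derivative_add, derivative_mul, derivative_C, derivative_X, zero_mul, zero_add,
      mul_one, add_zero, map_sub, map_mul]
    ring
  have h := congrArg (eval x₀) hI
  rw [hW] at h
  simp only [eval_mul, eval_add, eval_neg, eval_pow, eval_C, eval_X, Int.cast_ofNat,
    Int.cast_zero, map_zero, zero_mul, add_zero, Int.cast_neg, Int.cast_one, map_neg, map_one,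
    neg_mul, one_mul] at h
  linear_combination h

/-- **No datum of degree ≤ 1 joins `y² = x³ − x` to `y² = x³ + 4x`.** -/
theorem no_datum_of_degree_le_one {f g : ℚ[X]} {c : ℚ} (hf : f.natDegree ≤ 1)
    (hg : g.natDegree ≤ 1) : ¬ IsDatum (-1) 0 4 0 f g c := by
  intro hD
  have hc : c ≠ 0 := c_ne_zero_of_isDatum hD
  obtain ⟨hW, hI⟩ := hD
  rw [eq_X_add_C_of_natDegree_le_one hf, eq_X_add_C_of_natDegree_le_one hg] at hW hI
  set p := f.coeff 1 with hp
  set q := f.coeff 0 with hq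
  set s := g.coeff 1 with hs
  set t := g.coeff 0 with ht
  have hw : p * t - q * s ≠ 0 := by
    intro h0
    apply hW
    have : derivative (C p * X + C q) * (C s * X + C t) - (C p * X + C q) * derivative (C s * X + C t)
        = C (p * t - q * s) := by
      simp only [derivative_add, derivative_mul, derivative_C, derivative_X, zero_mul, zero_add,
        mul_one, add_zero, map_sub, map_mul]
      ring
    rw [this, h0, map_zero]
  have E0 := eval_identity_linear hI 0
  have E1 := eval_identity_linear hI 1
  have Em1 := eval_identity_linear hI (-1)
  have E2 := eval_identity_linear hI 2
  have Em2 := eval_identity_linear hI (-2)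
  have hc2 : 0 < c ^ 2 := by positivity
  -- coefficients of x⁴, x³, x¹, x⁰ of the identity
  have d4 : c ^ 2 * (p * s * (p ^ 2 + 4 * s ^ 2)) = 0 := by
    linear_combination (E2 - 4 * E1 + 6 * E0 - 4 * Em1 + Em2) / 24
  have d0 : c ^ 2 * (q * t * (q ^ 2 + 4 * t ^ 2)) = 0 := by linear_combination E0
  have d3 : c ^ 2 * (p ^ 3 * t + 3 * p ^ 2 * q * s + 12 * p * s ^ 2 * t + 4 * q * s ^ 3) =
      (p * t - q * s) ^ 2 := by
    linear_combination ((E2 - Em2) - 2 * (E1 - Em1)) / 12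
  have d1 : c ^ 2 * (3 * p * q ^ 2 * t + q ^ 3 * s + 4 * p * t ^ 3 + 12 * q * s * t ^ 2) =
      -(p * t - q * s) ^ 2 := by
    linear_combination (8 * (E1 - Em1) - (E2 - Em2)) / 12
  have d4' : p * s * (p ^ 2 + 4 * s ^ 2) = 0 := by
    rcases mul_eq_zero.mp d4 with h | h
    · exact absurd h hc2.ne'
    · exact h
  have d0' : q * t * (q ^ 2 + 4 * t ^ 2) = 0 := by
    rcases mul_eq_zero.mp d0 with h | h
    · exact absurd h hc2.ne'
    · exact h
  by_cases hp0 : p = 0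
  · -- then `q ≠ 0`, `s ≠ 0`, `t = 0`
    have hq0 : q ≠ 0 := by intro h; apply hw; rw [hp0, h]; ring
    have hs0 : s ≠ 0 := by intro h; apply hw; rw [hp0, h]; ring
    have ht0 : t = 0 := by
      have hpos : 0 < q ^ 2 + 4 * t ^ 2 := by positivity
      rcases mul_eq_zero.mp d0' with h | h
      · rcases mul_eq_zero.mp h with h | h
        · exact absurd h hq0
        · exact h
      · exact absurd h hpos.ne'
    rw [hp0, ht0] at d3 d1
    -- d3 : c²·4qs³ = q²s², d1 : c²·q³s = −q²s²
    have e3 : 4 * c ^ 2 * s = q := by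
      have : q * s ^ 2 * (4 * c ^ 2 * s - q) = 0 := by linear_combination d3
      rcases mul_eq_zero.mp this with h | h
      · rcases mul_eq_zero.mp h with h | h
        · exact absurd h hq0
        · exact absurd (pow_eq_zero_iff two_ne_zero |>.mp h) hs0
      · linarith
    have e1 : c ^ 2 * q = -s := by
      have : q ^ 2 * s * (c ^ 2 * q + s) = 0 := by linear_combination d1
      rcases mul_eq_zero.mp this with h | h
      · rcases mul_eq_zero.mp h with h | h
        · exact absurd (pow_eq_zero_iff two_ne_zero |>.mp h) hq0
        · exact absurd h hs0
      · linarith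
    have : q * (1 + 4 * c ^ 4) = 0 := by linear_combination (-1 : ℚ) * e3 + 4 * c ^ 2 * e1
    rcases mul_eq_zero.mp this with h | h
    · exact hq0 h
    · have : (0 : ℚ) < 1 + 4 * c ^ 4 := by positivity
      linarith
  · -- then `s = 0`, `t ≠ 0`, `q = 0`
    have hs0 : s = 0 := by
      rcases mul_eq_zero.mp d4' with h | h
      · rcases mul_eq_zero.mp h with h | h
        · exact absurd h hp0
        · exact h
      · have : (0 : ℚ) < p ^ 2 + 4 * s ^ 2 := by positivity
        exact absurd h this.ne'
    have ht0 : t ≠ 0 := by intro h; apply hw; rw [hs0, h]; ring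
    have hq0 : q = 0 := by
      have hpos : 0 < q ^ 2 + 4 * t ^ 2 := by positivity
      rcases mul_eq_zero.mp d0' with h | h
      · rcases mul_eq_zero.mp h with h | h
        · exact h
        · exact absurd h ht0
      · exact absurd h hpos.ne'
    rw [hs0, hq0] at d3 d1
    -- d3 : c² p³ t = p² t², d1 : c²·4pt³ = −p²t²
    have e3 : c ^ 2 * p = t := by
      have : p ^ 2 * t * (c ^ 2 * p - t) = 0 := by linear_combination d3
      rcases mul_eq_zero.mp this with h | h
      · rcases mul_eq_zero.mp h with h | h
        · exact absurd (pow_eq_zero_iff two_ne_zero |>.mp h) hp0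
        · exact absurd h ht0
      · linarith
    have e1 : 4 * c ^ 2 * t = -p := by
      have : p * t ^ 2 * (4 * c ^ 2 * t + p) = 0 := by linear_combination d1
      rcases mul_eq_zero.mp this with h | h
      · rcases mul_eq_zero.mp h with h | h
        · exact absurd h hp0
        · exact absurd (pow_eq_zero_iff two_ne_zero |>.mp h) ht0
      · linarith
    have : t * (1 + 4 * c ^ 4) = 0 := by linear_combination (-1 : ℚ) * e3 + c ^ 2 * e1
    rcases mul_eq_zero.mp this with h | h
    · exact ht0 h
    · have : (0 : ℚ) < 1 + 4 * c ^ 4 := by positivity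
      linarith

/-- **Tightness of the antecedent's constant.** Any `(κ, c₀)` witnessing `DegreeHypothesis` has
`c₀ ≥ 2`: for the lemniscate pair the complexity `max(1, log max(|A|,|B|))` is `1` and no datum of
degree `≤ 1` exists. -/
theorem degreeHypothesis_const_ge_two {κ c₀ : ℝ}
    (h : ∀ (A B A' B' : ℤ), 4 * A ^ 3 + 27 * B ^ 2 ≠ 0 → 4 * A' ^ 3 + 27 * B' ^ 2 ≠ 0 →
      (∃ (f g : ℚ[X]) (c : ℚ), IsDatum A B A' B' f g c) →
      ∃ (f g : ℚ[X]) (c : ℚ), derivative f * g - f * derivative g ≠ 0 ∧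
        (XMapIdentity A B A' B' f g c ∧
          ((max f.natDegree g.natDegree : ℕ) : ℝ) ≤
            c₀ * (max 1 (Real.log (max |(A : ℝ)| |(B : ℝ)|))) ^ κ)) :
    2 ≤ c₀ := by
  obtain ⟨f, g, c, hW, hI, hdeg⟩ :=
    h (-1) 0 4 0 (by norm_num) (by norm_num) ⟨_, _, _, isDatum_lemniscate⟩
  have hM : max 1 (Real.log (max |((-1 : ℤ) : ℝ)| |((0 : ℤ) : ℝ)|)) = 1 := by simp
  rw [hM, Real.one_rpow, mul_one] at hdeg
  have h2 : 2 ≤ max f.natDegree g.natDegree := by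
    by_contra hlt
    have hle : max f.natDegree g.natDegree ≤ 1 := Nat.lt_succ_iff.mp (Nat.lt_of_not_le hlt)
    exact no_datum_of_degree_le_one (le_of_max_le_left hle) (le_of_max_le_right hle) ⟨hW, hI⟩
  calc (2 : ℝ) ≤ ((max f.natDegree g.natDegree : ℕ) : ℝ) := by exact_mod_cast h2
    _ ≤ c₀ := hdeg

/-- The same for the typed `DegreeHypothesis`: every witness has `c₀ ≥ 2`. -/
theorem degreeHypothesis_witness_ge_two {κ c₀ : ℝ}
    (h : ∀ (A B A' B' : ℤ), 4 * A ^ 3 + 27 * B ^ 2 ≠ 0 → 4 * A' ^ 3 + 27 * B' ^ 2 ≠ 0 →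
      (∃ (f g : ℚ[X]) (c : ℚ), IsDatum A B A' B' f g c) →
      ∃ (f g : ℚ[X]) (c : ℚ), derivative f * g - f * derivative g ≠ 0 ∧
        (XMapIdentity A B A' B' f g c ∧
          ((max f.natDegree g.natDegree : ℕ) : ℝ) ≤
            c₀ * (max 1 (Real.log (max |(A : ℝ)| |(B : ℝ)|))) ^ κ)) :
    ¬ c₀ < 2 :=
  not_lt.mpr (degreeHypothesis_const_ge_two h)

end Tightness

end Summit.KontsevichZagierPeriods.KontsevichZagierPeriods.Cruxes.EffectiveXMapChains.Disproof
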